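import Literature.Topology.FourManifolds.PlanarArch
import HarnessLib

/-!
# The rise of the attaching circle into the flat strip as a graph over the height

Topic `Literature/Topology/FourManifolds`; fact seat `provefact-IsStrictHandleSlide.isSurgery`
(R. C. Kirby, *The Topology of 4-Manifolds*, LNM 1374 (1989), Ch. I §4; remaining content: the
named fact (S) `Literature.Topology.FourManifolds.FramedLink.IsStrictHandleSlide.slideModel`).
In band coordinates `(x₀, x₁)` (abscissa, height) the lower branch of the reshaped attaching
circle runs from the left edge (`x₀ = 0`, on `Kᵢ`) into the flat strip at the push-off and down
the common stub of the pillbox picture, as a **graph over the height** `x₀ = riseGraph h`: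
a free part `(1 - κ) · smoothStep (h_lo + ε_h) h_e` blended (on `[h_e, h_j]`) into the stub part
`1 - (r h - R)/(R e h)`, `r h = r_D + (θ h - θ_D)/ι` (the tilted stub ray `θ = θ_D + ι (r - r_D)` of
the slice picture read through the flat chart `r = R (1 + (1 - x₀) e h)`, `θ = θ h`). The data
(`θ`, `e` and the constants) are bundled in `RiseData` with the hypotheses actually used; proved:
smoothness on the height window, the plateau/stub formulas, bounds and monotonicity
(`(1 - S) a + S b` with `a ≤ b` both non-decreasing is non-decreasing).

* `RiseData` (structure), `RiseData.stubGraph`, `RiseData.riseGraph` (definitions) and their API.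

## References

* R. C. Kirby, *The Topology of 4-Manifolds*, LNM 1374, Springer (1989), Ch. I §4. [Kirby1989]
-/

open scoped ContDiff Topology
open Set Real

noncomputable section

namespace Literature.Topology.FourManifolds

/-- **Data of the rise.** `θ` (slice angle as a function of the height: smooth with negative
derivative on the open height window `(w₁, w₂)`), `e` (edge rate: smooth and positive on the
window), the slice radius `R > 0` of the push-off, the tip `(r_D, θ_D)` with `r_D ≥ R`, the tilt
`ι > 0`, the strip depth `κ ∈ (0, 1)`, and heights `w₁ < h_lo < h_lo + ε_h < h_e < h_j ≤ h_D < w₂`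
such that on `[h_e, w₂)` the stub abscissa is at least `1 - κ` (`r h ≤ R (1 + κ e h)`) and on
`[h_lo, h_D]` the stub ray stays outside the push-off (`θ h ≥ θ_D`). [cite: Kirby1989, Ch. I §4] -/
structure RiseData where
  θ : ℝ → ℝ
  e : ℝ → ℝ
  R : ℝ
  rD : ℝ
  θD : ℝ
  ι : ℝ
  κ : ℝ
  w₁ : ℝ
  w₂ : ℝ
  hlo : ℝ
  εh : ℝ
  he : ℝ
  hj : ℝ
  hD : ℝ
  θ_smooth : ContDiffOn ℝ ∞ θ (Ioo w₁ w₂)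
  e_smooth : ContDiffOn ℝ ∞ e (Ioo w₁ w₂)
  θ_deriv_neg : ∀ h ∈ Ioo w₁ w₂, deriv θ h < 0
  e_pos : ∀ h ∈ Ioo w₁ w₂, 0 < e h
  R_pos : 0 < R
  R_le_rD : R ≤ rD
  ι_pos : 0 < ι
  κ_pos : 0 < κ
  κ_lt : κ < 1
  marks : w₁ < hlo ∧ 0 < εh ∧ hlo + εh < he ∧ he < hj ∧ hj ≤ hD ∧ hD < w₂
  /-- On `[h_e, w₂)` the stub ray lies within the strip: `r h ≤ R (1 + κ e h)`. -/
  stub_in_strip : ∀ h ∈ Ico he w₂, rD + (θ h - θD) / ι ≤ R * (1 + κ * e h)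
  /-- The tip angle: `θ h_D = θ_D`. -/
  θ_hD : θ hD = θD

namespace RiseData

variable (d : RiseData)

/-- The slice radius along the stub ray at height `h`: `r_D + (θ h - θ_D)/ι`. [folklore] -/
def stubRadius (h : ℝ) : ℝ := d.rD + (d.θ h - d.θD) / d.ι

/-- **The stub as a graph over the height**: `1 - (r h - R)/(R e h)`. [folklore] -/
def stubGraph (h : ℝ) : ℝ := 1 - (d.stubRadius h - d.R) / (d.R * d.e h)

/-- **The rise as a graph over the height.** [cite: Kirby1989, Ch. I §4] -/
def riseGraph (h : ℝ) : ℝ :=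
  (1 - smoothStep d.he d.hj h) * ((1 - d.κ) * smoothStep (d.hlo + d.εh) d.he h) + smoothStep d.he d.hj h * d.stubGraph h

/-- Unfolding lemma. [folklore] -/
theorem stubRadius_def (h : ℝ) : d.stubRadius h = d.rD + (d.θ h - d.θD) / d.ι := rfl

/-- Unfolding lemma. [folklore] -/
theorem stubGraph_def (h : ℝ) : d.stubGraph h = 1 - (d.stubRadius h - d.R) / (d.R * d.e h) := rfl

/-- Unfolding lemma. [folklore] -/
theorem riseGraph_def (h : ℝ) : d.riseGraph h =
    (1 - smoothStep d.he d.hj h) * ((1 - d.κ) * smoothStep (d.hlo + d.εh) d.he h) +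
      smoothStep d.he d.hj h * d.stubGraph h := rfl

/-! ### Smoothness -/

/-- The stub radius is `C^∞` on the window. [folklore] -/
theorem contDiffOn_stubRadius : ContDiffOn ℝ ∞ d.stubRadius (Ioo d.w₁ d.w₂) := by
  unfold stubRadius
  exact contDiffOn_const.add ((d.θ_smooth.sub contDiffOn_const).div_const _)

/-- The stub graph is `C^∞` on the window. [folklore] -/
theorem contDiffOn_stubGraph : ContDiffOn ℝ ∞ d.stubGraph (Ioo d.w₁ d.w₂) := by
  unfold stubGraph
  refine contDiffOn_const.sub ((d.contDiffOn_stubRadius.sub contDiffOn_const).div (contDiffOn_const.mul d.e_smooth) ?_)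
  intro h hh
  exact mul_ne_zero d.R_pos.ne' (d.e_pos h hh).ne'

/-- The rise graph is `C^∞` on the window. [folklore] -/
theorem contDiffOn_riseGraph : ContDiffOn ℝ ∞ d.riseGraph (Ioo d.w₁ d.w₂) := by
  unfold riseGraph
  have h1 := (contDiff_smoothStep d.he d.hj).contDiffOn (s := Ioo d.w₁ d.w₂)
  have h2 := (contDiff_smoothStep (d.hlo + d.εh) d.he).contDiffOn (s := Ioo d.w₁ d.w₂)
  exact ((contDiffOn_const.sub h1).mul (contDiffOn_const.mul h2)).add (h1.mul d.contDiffOn_stubGraph)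

/-! ### Plateaux -/

/-- Below `h_lo + ε_h` the rise graph vanishes (the track is on the left edge). [folklore] -/
theorem riseGraph_of_le {h : ℝ} (hh : h ≤ d.hlo + d.εh) : d.riseGraph h = 0 := by
  obtain ⟨-, hε, h1, h2, -⟩ := d.marks
  rw [riseGraph, smoothStep_of_le h1 hh, smoothStep_of_le h2 (by linarith)]
  ring

/-- Above `h_j` the rise graph is the stub graph. [folklore] -/
theorem riseGraph_of_ge {h : ℝ} (hh : d.hj ≤ h) : d.riseGraph h = d.stubGraph h := by
  obtain ⟨-, hε, h1, h2, -⟩ := d.marks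
  rw [riseGraph, smoothStep_of_ge h2 hh]
  ring

/-- At the tip the stub radius is `r_D`. [folklore] -/
theorem stubRadius_hD : d.stubRadius d.hD = d.rD := by
  rw [stubRadius, d.θ_hD, sub_self, zero_div, add_zero]

/-- At the tip the rise graph is `1 - (r_D - R)/(R e h_D)`. [folklore] -/
theorem riseGraph_hD : d.riseGraph d.hD = 1 - (d.rD - d.R) / (d.R * d.e d.hD) := by
  rw [d.riseGraph_of_ge d.marks.2.2.2.2.1, stubGraph, stubRadius_hD]

/-! ### Bounds -/

/-- On `[h_e, w₂)` the stub graph is at least `1 - κ`. [folklore] -/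
theorem le_stubGraph {h : ℝ} (hh : h ∈ Ico d.he d.w₂) : 1 - d.κ ≤ d.stubGraph h := by
  obtain ⟨hw, hε, h1, h2, h3, h4⟩ := d.marks
  have hwin : h ∈ Ioo d.w₁ d.w₂ := ⟨by linarith [hh.1], hh.2⟩
  have he := d.e_pos h hwin
  have hR := d.R_pos
  have hs := d.stub_in_strip h hh
  rw [stubGraph, stubRadius]
  rw [sub_le_sub_iff_left, div_le_iff₀ (by positivity)]
  nlinarith

/-- Where the stub ray is outside the push-off (`θ h ≥ θ_D`, i.e. below the tip height) the stub
graph is at most `1`. [folklore] -/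
theorem stubGraph_le_one {h : ℝ} (hwin : h ∈ Ioo d.w₁ d.w₂) (hθ : d.θD ≤ d.θ h) : d.stubGraph h ≤ 1 := by
  have he := d.e_pos h hwin
  have hR := d.R_pos
  rw [stubGraph, stubRadius, sub_le_self_iff]
  apply div_nonneg _ (by positivity)
  have : 0 ≤ (d.θ h - d.θD) / d.ι := div_nonneg (by linarith) d.ι_pos.le
  linarith [d.R_le_rD]

/-- Below the tip height the angle is at least `θ_D`. [folklore] -/
theorem θD_le_θ {h : ℝ} (hwin : d.w₁ < h) (hh : h ≤ d.hD) : d.θD ≤ d.θ h := by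
  rcases hh.eq_or_lt with rfl | hlt
  · rw [d.θ_hD]
  · have hanti : StrictAntiOn d.θ (Icc h d.hD) := by
      apply strictAntiOn_of_deriv_neg (convex_Icc _ _)
        (d.θ_smooth.continuousOn.mono (Icc_subset_Ioo hwin d.marks.2.2.2.2.2))
      intro x hx
      rw [interior_Icc] at hx
      exact d.θ_deriv_neg x ⟨by linarith [hx.1], by linarith [hx.2, d.marks.2.2.2.2.2]⟩
    rw [← d.θ_hD]
    exact (hanti ⟨le_rfl, hlt.le⟩ ⟨hlt.le, le_rfl⟩ hlt).le

/-- **The rise graph takes values in `[0, 1]` on `[w₁, h_D]`.** [folklore] -/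
theorem riseGraph_mem_Icc {h : ℝ} (hwin : d.w₁ < h) (hh : h ≤ d.hD) : d.riseGraph h ∈ Icc (0 : ℝ) 1 := by
  obtain ⟨hw, hε, h1, h2, h3, h4⟩ := d.marks
  have hS := smoothStep_mem_Icc d.he d.hj h
  have hF := smoothStep_mem_Icc (d.hlo + d.εh) d.he h
  have hκ := d.κ_pos
  have hκ1 := d.κ_lt
  rw [riseGraph]
  rcases lt_or_ge h d.he with hlt | hge
  · rw [smoothStep_of_le h2 hlt.le]
    constructor <;> nlinarith [hF.1, hF.2]
  · have hwin' : h ∈ Ioo d.w₁ d.w₂ := ⟨hwin, by linarith⟩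
    have hlo := d.le_stubGraph ⟨hge, hwin'.2⟩
    have hhi := d.stubGraph_le_one hwin' (d.θD_le_θ hwin hh)
    have hA : 0 ≤ (1 - d.κ) * smoothStep (d.hlo + d.εh) d.he h := by nlinarith [hF.1]
    have hA' : (1 - d.κ) * smoothStep (d.hlo + d.εh) d.he h ≤ 1 := by nlinarith [hF.2]
    constructor <;> nlinarith [hS.1, hS.2]

/-! ### Monotonicity -/

/-- The derivative of the stub graph. [folklore] -/
theorem hasDerivAt_stubGraph {h : ℝ} (hwin : h ∈ Ioo d.w₁ d.w₂) :
    HasDerivAt d.stubGraph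
      (((d.stubRadius h - d.R) * (d.R * deriv d.e h) - (deriv d.θ h / d.ι) * (d.R * d.e h)) / (d.R * d.e h) ^ 2) h := by
  have hθ : HasDerivAt d.θ (deriv d.θ h) h := ((d.θ_smooth.contDiffAt (Ioo_mem_nhds hwin.1 hwin.2)).differentiableAt (by simp)).hasDerivAt
  have he : HasDerivAt d.e (deriv d.e h) h := ((d.e_smooth.contDiffAt (Ioo_mem_nhds hwin.1 hwin.2)).differentiableAt (by simp)).hasDerivAt
  have hr : HasDerivAt d.stubRadius (deriv d.θ h / d.ι) h := by
    have h1 : HasDerivAt (fun x ↦ d.rD + (d.θ x - d.θD) / d.ι) (0 + deriv d.θ h / d.ι) h :=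
      (hasDerivAt_const h d.rD).add ((hθ.sub_const d.θD).div_const d.ι)
    rw [zero_add] at h1
    exact h1.congr_of_eventuallyEq (Filter.Eventually.of_forall fun x ↦ rfl)
  have hnum : HasDerivAt (fun h ↦ d.stubRadius h - d.R) (deriv d.θ h / d.ι) h := by simpa using hr.sub_const d.R
  have hden : HasDerivAt (fun h ↦ d.R * d.e h) (d.R * deriv d.e h) h := he.const_mul d.R
  have hne : d.R * d.e h ≠ 0 := mul_ne_zero d.R_pos.ne' (d.e_pos h hwin).ne'
  have h2 : HasDerivAt (fun x ↦ 1 - (d.stubRadius x - d.R) / (d.R * d.e x))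
      (0 - ((deriv d.θ h / d.ι) * (d.R * d.e h) - (d.stubRadius h - d.R) * (d.R * deriv d.e h)) / (d.R * d.e h) ^ 2) h :=
    (hasDerivAt_const h (1 : ℝ)).sub (hnum.div hden hne)
  refine (h2.congr_of_eventuallyEq (Filter.Eventually.of_forall fun x ↦ rfl)).congr_deriv ?_
  ring

/-- **The stub graph is strictly increasing in the height** as soon as
`(θ' h / ι) · e h < (r h - R) · e' h` (automatic when `e' h ≥ 0`, since `θ' < 0` and `r h ≥ R`;
in general a smallness condition on `r h - R`, i.e. on the strip depth). [folklore] -/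
theorem deriv_stubGraph_pos {h : ℝ} (hwin : h ∈ Ioo d.w₁ d.w₂)
    (hineq : (deriv d.θ h / d.ι) * d.e h < (d.stubRadius h - d.R) * deriv d.e h) : 0 < deriv d.stubGraph h := by
  rw [(d.hasDerivAt_stubGraph hwin).deriv]
  have he := d.e_pos h hwin
  have hR := d.R_pos
  have hden : 0 < (d.R * d.e h) ^ 2 := by positivity
  apply div_pos _ hden
  have : (d.stubRadius h - d.R) * (d.R * deriv d.e h) - (deriv d.θ h / d.ι) * (d.R * d.e h) =
      d.R * ((d.stubRadius h - d.R) * deriv d.e h - (deriv d.θ h / d.ι) * d.e h) := by ring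
  rw [this]
  exact mul_pos hR (by linarith)

/-- **Monotone blend**: if on the blend zone `[h_e, h_j]` the free part is at most the stub part
and both are non-decreasing, the rise graph is non-decreasing there; recorded in derivative form.
[folklore] -/
theorem deriv_riseGraph_nonneg {h : ℝ} (hwin : h ∈ Ioo d.w₁ d.w₂)
    (horder : d.he ≤ h → h ≤ d.hj → (1 - d.κ) * smoothStep (d.hlo + d.εh) d.he h ≤ d.stubGraph h)
    (hstub : d.he ≤ h → 0 ≤ deriv d.stubGraph h) : 0 ≤ deriv d.riseGraph h := by
  obtain ⟨hw, hε, h1, h2, h3, h4⟩ := d.marks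
  -- derivatives of the pieces
  have hS : HasDerivAt (smoothStep d.he d.hj) (deriv (smoothStep d.he d.hj) h) h :=
    (((contDiff_smoothStep _ _).differentiable (by simp)) h).hasDerivAt
  have hF : HasDerivAt (smoothStep (d.hlo + d.εh) d.he) (deriv (smoothStep (d.hlo + d.εh) d.he) h) h :=
    (((contDiff_smoothStep _ _).differentiable (by simp)) h).hasDerivAt
  have hG : HasDerivAt d.stubGraph (deriv d.stubGraph h) h :=
    ((d.contDiffOn_stubGraph.contDiffAt (Ioo_mem_nhds hwin.1 hwin.2)).differentiableAt (by simp)).hasDerivAt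
  have hR : HasDerivAt d.riseGraph
      ((0 - deriv (smoothStep d.he d.hj) h) * ((1 - d.κ) * smoothStep (d.hlo + d.εh) d.he h) +
        (1 - smoothStep d.he d.hj h) * ((1 - d.κ) * deriv (smoothStep (d.hlo + d.εh) d.he) h) +
        (deriv (smoothStep d.he d.hj) h * d.stubGraph h + smoothStep d.he d.hj h * deriv d.stubGraph h)) h := by
    have := (((hasDerivAt_const h (1 : ℝ)).sub hS).mul (hF.const_mul (1 - d.κ))).add (hS.mul hG)
    exact this.congr_of_eventuallyEq (Filter.Eventually.of_forall fun x ↦ rfl)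
  rw [hR.deriv]
  have hS' := deriv_smoothStep_nonneg h2 h
  have hF' := deriv_smoothStep_nonneg h1 h
  have hSI := smoothStep_mem_Icc d.he d.hj h
  have hFI := smoothStep_mem_Icc (d.hlo + d.εh) d.he h
  have hκ := d.κ_lt
  rcases lt_or_ge h d.he with hlt | hge
  · -- below the blend zone: only the free part moves
    rw [deriv_smoothStep_of_lt h2 hlt, smoothStep_of_le h2 hlt.le]
    have : 0 ≤ (1 - d.κ) * deriv (smoothStep (d.hlo + d.εh) d.he) h := mul_nonneg (by linarith) hF'
    nlinarith
  rcases le_or_gt h d.hj with hle | hgt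
  · -- in the blend zone
    have ho := horder hge hle
    have hs := hstub hge
    have t1 : 0 ≤ deriv (smoothStep d.he d.hj) h * (d.stubGraph h - (1 - d.κ) * smoothStep (d.hlo + d.εh) d.he h) :=
      mul_nonneg hS' (by linarith)
    have t2 : 0 ≤ (1 - smoothStep d.he d.hj h) * ((1 - d.κ) * deriv (smoothStep (d.hlo + d.εh) d.he) h) :=
      mul_nonneg (by linarith [hSI.2]) (mul_nonneg (by linarith) hF')
    have t3 : 0 ≤ smoothStep d.he d.hj h * deriv d.stubGraph h := mul_nonneg hSI.1 hs
    nlinarith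
  · -- above: only the stub part moves
    rw [deriv_smoothStep_of_gt h2 hgt, smoothStep_of_ge h2 hgt.le]
    have := hstub hge
    nlinarith

end RiseData

end Literature.Topology.FourManifolds
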